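import Summits.CriticalPhenomena.Ising3DConformalLimit.Theorems.HyperoctahedralRPExistsScaleCovariantLimitLatticeFormsItemMaps
import Summits.CriticalPhenomena.Ising3DConformalLimit.Theorems.HyperoctahedralRPExistsScaleCovariantLimitGeomPairLimitPos
import Summits.CriticalPhenomena.Ising3DConformalLimit.Theorems.HyperoctahedralRPExistsScaleCovariantLimitCruxIffOrbitPrecompactPointwiseLimit
import HarnessLib

/-!
# One dyadic pair ratio gives all-scale doubling: the compactness half of the crux is implied by its uniqueness half
(line `Sketch` of the crux `ExistsScaleCovariantLimit`, item stmt-CriticalPhenomena-1981, route `HyperoctahedralRP`;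
registered stub D6 `stub_twoPointDoubling_of_dyadicPairRatio`; lead c6, 2026-08-16)

Write `g(m) = ⟨σ₀σ_{m e₀}⟩_{β_c}` for the axial critical two-point function of the n.n. Ising model on `ℤ³` and
`F_n(δ) = rescaledCorrelator (criticalCorr 3) rhoPin n δ` for the pinned zoom. At the mesh `2^{-k}` and the integer pair
`(0, 2e₀)` the pinned zoom is EXACTLY the doubling ratio `g(2^{k+1})/g(2^k)` (`pz_two_geomPair`).

* `stub_twoPointDoubling_of_dyadicPairRatio` — **if `g(2^{k+1})/g(2^k)` converges then item 6150 `TwoPointDoubling` holds**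
  (`κ g(n) ≤ g(2n)` for ALL `n ≥ 1`): the limit `L` is positive (landed P `stub_geomPairLimit_pos`: Simon–Lieb chain argument against
  `g(m) ≥ c m⁻²`), so `g(2^{k+1}) ≥ (L/2) g(2^k)` for `k ≥ k₀`; for `2^k ≤ n < 2^{k+1}` Messager–Miracle-Solé axis antitonicity gives
  `g(2n) ≥ g(2^{k+2}) ≥ (L/2)² g(2^k) ≥ (L/2)² g(n)`, and the finitely many `n < 2^{k₀}` are absorbed by `g(2n) ≥ g(2^{k₀+1})`, `g(n) ≤ 1`.
* `twoPointDoubling_of_dyadicIntConvergence`, `orbitPrecompact_of_dyadicIntConvergence` — **S2' ⟹ item 6150 ⟹ item 5955**: the registered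
  open stub S2' (dyadic integer-configuration convergence) CONTAINS the registered open stub S1 (= item 5955 `OrbitPrecompact`), by the
  landed `orbitPrecompact_of_doubling` (F5 chain, p120504).
* `crux_iff_dyadicInt_triadicInt` — **crux ⟺ S2' ∧ S3'**: two single-hierarchy integer-configuration convergences ARE the full
  locally-uniform scale-covariant limit, compactness included ("two hierarchies force the filter", the line's card, in full).
* `crux_iff_intMeshConvergence` — **crux ⟺ [for every `n` and non-coincident `y ∈ (ℤ³)ⁿ`, `m ↦ ⟨∏ᵢσ_{m yᵢ}⟩_{β_c}/g(m)^{n/2}` converges]**.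
* `twoPointDoubling_of_pointwiseLimit`, `crux_iff_pointwiseLimit` — **item 6153 ⟹ item 6150, so crux ⟺ ITEM 6153 `PointwiseLimit` ALONE**
  (previously crux ⟺ 5955 ∧ 6153, p116283, and ⟺ 6150 ∧ 6153, p120504).
* `twoPointDoubling_of_zoomMonotone`, `orbitPrecompact_of_zoomMonotone`, `crux_of_zoomMonotone`, `monotoneRG_target_of_zoomMonotone` —
  **item 14454 `ZoomMonotone` ALONE ⟹ the crux** = route `MonotoneRG`'s target (previously 6150 ∧ 14454, p122713; 4658 ∧ 14454, p103222).

References: H. Duminil-Copin, ICM 2022 §8.4 p. 29 [DuminilCopinICM2022]; M. Aizenman, H. Duminil-Copin, Ann. Math. 194 (2021),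
arXiv:1912.07973, Remark 5.10 [AizenmanDuminilCopinAnnals2021]; A. Messager, S. Miracle-Solé, J. Stat. Phys. 17 (1977)
[MessagerMiracleSoleJSP1977]. No definitions, no named-fact hypotheses, no `sorry`.
-/

noncomputable section

namespace Summit.CriticalPhenomena.Ising3DConformalLimit.Cruxes.ExistsScaleCovariantLimit.TwoHierarchies

open Literature.Probability.LatticeModels Filter Set
open scoped Topology
open Summit.CriticalPhenomena.Ising3DConformalLimit.MoebiusLimitExistsOnlyInteraction (rhoPin)
open Summit.CriticalPhenomena.Ising3DConformalLimit.ExistsScaleCovariantLimitNegative.Dyadic (tendsto_dyad)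
open Summit.CriticalPhenomena.Ising3DConformalLimit.Theses

/-! ## The doubling lemma -/

/-- **D6 — one convergent dyadic pair ratio gives item 6150 `TwoPointDoubling`.** If the pinned pair zoom at `(0, 2e₀)` converges
along the dyadic meshes `2^{-k}` — i.e. the doubling ratio `g(2^{k+1})/g(2^k)` of the axial critical two-point function converges — then
`κ g(n) ≤ g(2n)` for all `n ≥ 1` with some `κ > 0`: the limit is positive (P `stub_geomPairLimit_pos`), so the dyadic ratios are
eventually `≥ L/2`, and Messager–Miracle-Solé axis antitonicity interpolates between consecutive dyadic scales.
[cite: AizenmanDuminilCopinAnnals2021, arXiv:1912.07973 Remark 5.10] -/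
theorem stub_twoPointDoubling_of_dyadicPairRatio :
    (∃ L : ℝ, Tendsto (fun k : ℕ => rescaledCorrelator (criticalCorr 3) rhoPin 2 (((2:ℝ) ^ k)⁻¹)
        (![0, EuclideanSpace.single 0 (2:ℝ)] : Fin 2 → EuclideanSpace ℝ (Fin 3))) atTop (𝓝 L)) →
    MirrorHoelderCompactness.TwoPointDoubling := by
  rintro ⟨L, hL⟩
  have hgpos : ∀ m : ℕ, 0 < criticalTwoPoint 3 (Pi.single 0 (m : ℤ)) := criticalTwoPoint_axis_pos
  have hanti : Antitone (fun m : ℕ => criticalTwoPoint 3 (Pi.single 0 (m : ℤ))) :=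
    Literature.Probability.LatticeModels.criticalTwoPoint_axis_antitone
  set g : ℕ → ℝ := fun m => criticalTwoPoint 3 (Pi.single 0 (m : ℤ)) with hg
  -- the hypothesis in the `(b:ℝ)^a` bookkeeping of `pz_two_geomPair` / `stub_geomPairLimit_pos` (`b = 2`, `a = 1`)
  have hL' : Tendsto (fun j : ℕ => rescaledCorrelator (criticalCorr 3) rhoPin 2 (((((2:ℕ):ℝ)) ^ j)⁻¹)
      (![0, EuclideanSpace.single 0 (((2:ℕ):ℝ) ^ 1)] : Fin 2 → EuclideanSpace ℝ (Fin 3))) atTop (𝓝 L) := by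
    have e1 : (((2:ℕ):ℝ) ^ 1) = (2:ℝ) := by norm_num
    have e2 : ∀ j : ℕ, (((2:ℕ):ℝ) ^ j) = (2:ℝ) ^ j := fun j => by norm_num
    simp only [e1, e2]
    exact hL
  -- positivity of the limit (P) and the ratio form of the sequence
  have hLpos : 0 < L := stub_geomPairLimit_pos 2 le_rfl 1 L hL'
  have hr : Tendsto (fun j : ℕ => g (2 ^ (1 + j)) / g (2 ^ j)) atTop (𝓝 L) :=
    hL'.congr fun j => pz_two_geomPair 2 1 j
  have hL2 : 0 < L / 2 := by positivity
  have hev : ∀ᶠ j in atTop, L / 2 < g (2 ^ (1 + j)) / g (2 ^ j) :=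
    hr.eventually (Ioi_mem_nhds (by linarith))
  obtain ⟨k₀, hk₀⟩ := eventually_atTop.1 hev
  -- eventual dyadic doubling: `(L/2) g(2^k) ≤ g(2^(k+1))` for `k ≥ k₀`
  have hstep : ∀ k, k₀ ≤ k → L / 2 * g (2 ^ k) ≤ g (2 ^ (k + 1)) := by
    intro k hk
    have h := (hk₀ k hk).le
    rw [le_div_iff₀ (hgpos _), add_comm] at h
    exact h
  -- the doubling constant
  set κ : ℝ := min ((L / 2) ^ 2) (g (2 ^ (k₀ + 1))) with hκ
  have hκpos : 0 < κ := lt_min (by positivity) (hgpos _)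
  refine ⟨κ, hκpos, fun n hn => ?_⟩
  have e2n : (Pi.single 0 (2 * (n : ℤ)) : Site 3) = Pi.single 0 (((2 * n : ℕ)) : ℤ) := by
    push_cast; rfl
  rw [e2n]
  change κ * g n ≤ g (2 * n)
  have hgn0 : 0 ≤ g n := (hgpos n).le
  rcases Nat.lt_or_ge n (2 ^ k₀) with hsmall | hlarge
  · -- finitely many small `n`: `κ g(n) ≤ g(2^(k₀+1)) ≤ g(2n)` since `2n ≤ 2^(k₀+1)` and `g(n) ≤ 1`
    have h1 : κ * g n ≤ g (2 ^ (k₀ + 1)) := by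
      calc κ * g n ≤ g (2 ^ (k₀ + 1)) * g n :=
            mul_le_mul_of_nonneg_right (min_le_right _ _) hgn0
        _ ≤ g (2 ^ (k₀ + 1)) * 1 :=
            mul_le_mul_of_nonneg_left (criticalTwoPoint_le_one' _) (hgpos _).le
        _ = g (2 ^ (k₀ + 1)) := mul_one _
    have h2n : 2 * n ≤ 2 ^ (k₀ + 1) := by rw [pow_succ]; omega
    exact h1.trans (hanti h2n)
  · -- large `n`: `2^k ≤ n < 2^(k+1)` with `k ≥ k₀`
    set k : ℕ := Nat.log 2 n with hk
    have hn0 : n ≠ 0 := by omega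
    have hkn : 2 ^ k ≤ n := Nat.pow_log_le_self 2 hn0
    have hnk : n < 2 ^ (k + 1) := Nat.lt_pow_succ_log_self (by norm_num) n
    have hk₀k : k₀ ≤ k := Nat.le_log_of_pow_le (by norm_num) hlarge
    have h2n : 2 * n ≤ 2 ^ (k + 2) := by
      rw [pow_succ, pow_succ] at *
      omega
    calc κ * g n ≤ (L / 2) ^ 2 * g n := mul_le_mul_of_nonneg_right (min_le_left _ _) hgn0
      _ ≤ (L / 2) ^ 2 * g (2 ^ k) := mul_le_mul_of_nonneg_left (hanti hkn) (by positivity)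
      _ = L / 2 * (L / 2 * g (2 ^ k)) := by ring
      _ ≤ L / 2 * g (2 ^ (k + 1)) := mul_le_mul_of_nonneg_left (hstep k hk₀k) hL2.le
      _ ≤ g (2 ^ (k + 1 + 1)) := hstep (k + 1) (by omega)
      _ ≤ g (2 * n) := hanti h2n

/-! ## S2' contains S1: the uniqueness half of the crux carries its compactness half -/

/-- The integer pair `(0, 2e₀)` is non-coincident. [folklore] -/
theorem cfg0_two_mem :
    (![0, EuclideanSpace.single 0 (2:ℝ)] : Fin 2 → EuclideanSpace ℝ (Fin 3)) ∈ NonCoincident 3 2 :=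
  zero_unitVec_mem_nonCoincident (by norm_num)

/-- The integer pair `(0, 2e₀)` has integer coordinates. [folklore] -/
theorem cfg0_two_intCoord :
    ∀ i j, ∃ z : ℤ, (![0, EuclideanSpace.single 0 (2:ℝ)] : Fin 2 → EuclideanSpace ℝ (Fin 3)) i j = (z : ℝ) := by
  have h := cfg0_pow_intCoord 2 1
  have e1 : (((2:ℕ):ℝ) ^ 1) = (2:ℝ) := by norm_num
  rw [e1] at h
  exact h

/-- **S2' ⟹ item 6150**: dyadic integer-configuration convergence of the pinned zoom (the registered open stub
`stub_dyadicIntConvergence`, all orders) gives all-scale axis doubling — only its instance `n = 2`, `y = (0, 2e₀)` is used.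
[cite: AizenmanDuminilCopinAnnals2021, arXiv:1912.07973 Remark 5.10] -/
theorem twoPointDoubling_of_dyadicIntConvergence
    (hS2 : ∀ (n : ℕ) (y : Fin n → EuclideanSpace ℝ (Fin 3)), y ∈ NonCoincident 3 n →
      (∀ i j, ∃ z : ℤ, y i j = (z : ℝ)) →
      ∃ L : ℝ, Tendsto (fun k : ℕ => rescaledCorrelator (criticalCorr 3) rhoPin n (((2:ℝ) ^ k)⁻¹) y)
        atTop (𝓝 L)) :
    MirrorHoelderCompactness.TwoPointDoubling :=
  stub_twoPointDoubling_of_dyadicPairRatio (hS2 2 _ cfg0_two_mem cfg0_two_intCoord)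

/-- **S2' ⟹ item 5955 (= S1)**: dyadic integer-configuration convergence ALONE gives precompactness of the critical zoom orbit at
all orders (`twoPointDoubling_of_dyadicIntConvergence`, then the landed F5 chain `orbitPrecompact_of_doubling`).
[cite: DuminilCopinICM2022, §8.4 p. 29] -/
theorem orbitPrecompact_of_dyadicIntConvergence
    (hS2 : ∀ (n : ℕ) (y : Fin n → EuclideanSpace ℝ (Fin 3)), y ∈ NonCoincident 3 n →
      (∀ i j, ∃ z : ℤ, y i j = (z : ℝ)) →
      ∃ L : ℝ, Tendsto (fun k : ℕ => rescaledCorrelator (criticalCorr 3) rhoPin n (((2:ℝ) ^ k)⁻¹) y)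
        atTop (𝓝 L)) :
    MonotoneRG.OrbitPrecompact :=
  ItemMaps.orbitPrecompact_of_doubling (twoPointDoubling_of_dyadicIntConvergence hS2)

/-- **crux ⟺ S2' ∧ S3' — TWO HIERARCHIES FORCE THE FILTER, COMPACTNESS INCLUDED.** Existence of the locally-uniform, scale-covariant
full continuum limit of ALL critical `ℤ³` Ising correlators is EQUIVALENT to: for every `n` and every non-coincident integer
configuration `y ∈ (ℤ³)ⁿ`, the two explicit real sequences `⟨∏ᵢσ_{2^k yᵢ}⟩_{β_c}/⟨σ₀σ_{2^k e₀}⟩_{β_c}^{n/2}` and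
`⟨∏ᵢσ_{3^k yᵢ}⟩_{β_c}/⟨σ₀σ_{3^k e₀}⟩_{β_c}^{n/2}` converge (landed `crux_iff_orbitPrecompact_dyadicInt_triadicInt`, p120217, with
item 5955 now supplied by S2' itself). [cite: DuminilCopinICM2022, §8.4 p. 29] -/
theorem crux_iff_dyadicInt_triadicInt :
    HyperoctahedralRP.ExistsScaleCovariantLimit ↔
    ((∀ (n : ℕ) (y : Fin n → EuclideanSpace ℝ (Fin 3)), y ∈ NonCoincident 3 n →
      (∀ i j, ∃ z : ℤ, y i j = (z : ℝ)) →
      ∃ L : ℝ, Tendsto (fun k : ℕ => rescaledCorrelator (criticalCorr 3) rhoPin n (((2:ℝ) ^ k)⁻¹) y)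
        atTop (𝓝 L)) ∧
    (∀ (n : ℕ) (y : Fin n → EuclideanSpace ℝ (Fin 3)), y ∈ NonCoincident 3 n →
      (∀ i j, ∃ z : ℤ, y i j = (z : ℝ)) →
      ∃ L : ℝ, Tendsto (fun k : ℕ => rescaledCorrelator (criticalCorr 3) rhoPin n (((3:ℝ) ^ k)⁻¹) y)
        atTop (𝓝 L))) := by
  rw [ItemMaps.crux_iff_orbitPrecompact_dyadicInt_triadicInt]
  exact ⟨fun h => h.2, fun h => ⟨orbitPrecompact_of_dyadicIntConvergence h.1, h⟩⟩

/-- **crux ⟺ integer-mesh convergence at integer configurations** — ONE family of explicit real sequences: for every `n` and every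
non-coincident `y ∈ (ℤ³)ⁿ`, `m ↦ ⟨∏ᵢσ_{m yᵢ}⟩_{β_c} / ⟨σ₀σ_{m e₀}⟩_{β_c}^{n/2}` converges (landed `crux_iff_orbitPrecompact_intMeshConvergence`,
p122713; the integer meshes contain the dyadic ones, which supply item 5955). [cite: DuminilCopinICM2022, §8.4 p. 29] -/
theorem crux_iff_intMeshConvergence :
    HyperoctahedralRP.ExistsScaleCovariantLimit ↔
    (∀ (n : ℕ) (y : Fin n → EuclideanSpace ℝ (Fin 3)), y ∈ NonCoincident 3 n →
      (∀ i j, ∃ z : ℤ, y i j = (z : ℝ)) →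
      ∃ L : ℝ, Tendsto (fun m : ℕ => rescaledCorrelator (criticalCorr 3) rhoPin n (1 / (m:ℝ)) y) atTop (𝓝 L)) := by
  rw [ItemMaps.crux_iff_orbitPrecompact_intMeshConvergence]
  exact ⟨fun h => h.2, fun h =>
    ⟨orbitPrecompact_of_dyadicIntConvergence (ItemMaps.dyadicInt_triadicInt_of_intMeshConvergence h).1, h⟩⟩

/-! ## Item 6153 alone, item 14454 alone -/

/-- **Item 6153 ⟹ item 6150**: full-filter pointwise convergence of the pinned zoom (at the one pair `(0, 2e₀)`) gives all-scale
axis doubling. [cite: AizenmanDuminilCopinAnnals2021, arXiv:1912.07973 Remark 5.10] -/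
theorem twoPointDoubling_of_pointwiseLimit (hPL : MirrorHoelderCompactness.PointwiseLimit) :
    MirrorHoelderCompactness.TwoPointDoubling := by
  obtain ⟨l, hl⟩ := hPL 2 _ cfg0_two_mem
  rw [rhoStar_eq_rhoPin] at hl
  exact stub_twoPointDoubling_of_dyadicPairRatio ⟨l, hl.comp tendsto_dyad⟩

/-- **Item 6153 ⟹ item 5955.** [cite: DuminilCopinICM2022, §8.4 p. 29] -/
theorem orbitPrecompact_of_pointwiseLimit (hPL : MirrorHoelderCompactness.PointwiseLimit) :
    MonotoneRG.OrbitPrecompact :=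
  ItemMaps.orbitPrecompact_of_doubling (twoPointDoubling_of_pointwiseLimit hPL)

/-- **THE CRUX IS ITEM 6153 `PointwiseLimit` EXACTLY**: existence of the locally-uniform scale-covariant full limit of the critical
`ℤ³` Ising correlators ⟺ full-filter POINTWISE convergence of the pinned zoom at every non-coincident configuration (landed
`stub_cruxIffOrbitPrecompactPointwiseLimit`, p116283: crux ⟺ 5955 ∧ 6153; and 6153 ⟹ 5955). [cite: DuminilCopinICM2022, §8.4 p. 29] -/
theorem crux_iff_pointwiseLimit :
    HyperoctahedralRP.ExistsScaleCovariantLimit ↔ MirrorHoelderCompactness.PointwiseLimit := by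
  rw [stub_cruxIffOrbitPrecompactPointwiseLimit]
  exact ⟨fun h => h.2, fun h => ⟨orbitPrecompact_of_pointwiseLimit h, h⟩⟩

/-- Route `MonotoneRG`'s target (the shared decl) ⟺ item 6153. [cite: DuminilCopinICM2022, §8.4 p. 29] -/
theorem monotoneRG_target_iff_pointwiseLimit :
    MonotoneRG.ExistsScaleCovariantLimit ↔ MirrorHoelderCompactness.PointwiseLimit :=
  crux_iff_pointwiseLimit

/-- **Item 14454 ⟹ item 6150**: eventual monotonicity of the integer-mesh pinned zoom at integer configurations gives all-scale axis
doubling (`dyadicIntConvergence_of_zoomMonotone`, p122713). [cite: AizenmanDuminilCopinAnnals2021, arXiv:1912.07973 Remark 5.10] -/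
theorem twoPointDoubling_of_zoomMonotone (hZM : MonotoneRG.ZoomMonotone) : MirrorHoelderCompactness.TwoPointDoubling :=
  twoPointDoubling_of_dyadicIntConvergence (ItemMaps.dyadicIntConvergence_of_zoomMonotone hZM)

/-- **Item 14454 ⟹ item 5955.** [cite: DuminilCopinICM2022, §8.4 p. 29] -/
theorem orbitPrecompact_of_zoomMonotone (hZM : MonotoneRG.ZoomMonotone) : MonotoneRG.OrbitPrecompact :=
  orbitPrecompact_of_dyadicIntConvergence (ItemMaps.dyadicIntConvergence_of_zoomMonotone hZM)

/-- **ITEM 14454 `ZoomMonotone` ALONE ⟹ THE CRUX**: eventual monotonicity in `m` of the explicit ratios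
`⟨∏ᵢσ_{m yᵢ}⟩_{β_c}/⟨σ₀σ_{m e₀}⟩_{β_c}^{n/2}` at integer configurations gives the scale-covariant continuum limit of all critical `ℤ³`
Ising correlators ("ferromagnets cannot cycle" suffices; compactness comes for free). [cite: DuminilCopinICM2022, §8.4 p. 29] -/
theorem crux_of_zoomMonotone (hZM : MonotoneRG.ZoomMonotone) : HyperoctahedralRP.ExistsScaleCovariantLimit :=
  crux_iff_intMeshConvergence.2 (ItemMaps.intMeshConvergence_of_zoomMonotone hZM)

/-- Route `MonotoneRG`'s target from its single item 14454 (improves `zoomGlue_proof`, item 14455: 4658 ∧ 14454 ⟹ target, and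
`crux_of_doubling_zoomMonotone`: 6150 ∧ 14454 ⟹ target). [cite: DuminilCopinICM2022, §8.4 p. 29] -/
theorem monotoneRG_target_of_zoomMonotone (hZM : MonotoneRG.ZoomMonotone) : MonotoneRG.ExistsScaleCovariantLimit :=
  crux_of_zoomMonotone hZM

end Summit.CriticalPhenomena.Ising3DConformalLimit.Cruxes.ExistsScaleCovariantLimit.TwoHierarchies

end
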